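import Summits.BirchSwinnertonDyer.BirchSwinnertonDyer.Theorems.GenusKolyvaginAtTwoPowDvdShaCardAtTwoRTAuxiliaryClass
import Summits.BirchSwinnertonDyer.Rank1Residual.X11b.BDPRouteSelmerLevelBound
import HarnessLib

/-!
# Route `GenusKolyvaginAtTwo`, LINES 18/19 (L_T stmt-BirchSwinnertonDyer-23242, L⁺_T stmt-23379), step (b) input I5, part 5:
# McCALLUM'S PROP. 2.1 IN COUNTING FORM — THE SIZE OF THE SOLUTION GROUP with a SET of relaxed places:
# `#loc_T(V)² ≥ ∏_{w ∈ T∖S} #H¹(K_w, E[p^k])` (towards evasion (E1) of the `p = 2` Klein-four obstruction I4)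

Width seat `bsd-line-gk2-p4` g16 (cell `bsd-f1-sign2`), `--supports stmt-BirchSwinnertonDyer-23242` (helper; closes nothing).
THEOREMS ONLY: no definition, no named fact, no `sorry`; standard axioms.  BSD is NOT proved by any of this.
Sequel of parts 1–4 (`…RTAuxiliaryClassCount/…Class/…Invariant/…Places`).

WHY.  The remaining open input I4 of the 3a⁗ swap oracle (gk2-p2 g15 `Lines/plus-descent-step-b-prop52.md` §2) is a SIMULTANEOUS
non-vanishing Čebotarev condition for up to three classes killed by `2` which at `p = 2` can be `𝔽₂`-dependent («a Klein four-group
is the union of its three lines»).  Evasion (E1) there: «choose the auxiliary class GENERICALLY — Prop. 2.1's solution set is a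
GROUP … a good `c` exists as soon as that group is large enough; this needs the relaxation at `λ₀` AND at one more throw-away
prime».  McCallum's count proves MORE than `∃ c ≠ 0`: with `T = S ⊔ R` (`R` the RELAXED places, no condition there; McCallum:
`R = {w}`) and `V = {c ∈ H¹_{𝓛, ⊤ on T}(K, E[p^k]) : loc_v c ∈ H_v (v ∈ S)}` the solution group,

  `#loc_T(V)² ≥ ∏_{w ∈ R} #H¹(K_w, E[p^k])`,

so each relaxed Kolyvagin place of level `≥ k` contributes a factor `#E(K_w)[p^k] · #(𝓞_w/p^k)` to `#loc_T(V)` — the quantitative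
input (E1) asks for.  Proof = McCallum's pigeonhole read as an inequality: `G = loc_T(H¹_{𝓛, ⊤ on T})` has
`#G² = ∏_{v∈T} #H¹(K_v, E[p^k])` (part 1 `natCard_map_kummerOutside_sq`), the kernel of `G → Π_{v∈S} H¹(K_v)/H_v` is `loc_T(V)`, and
`#(H¹(K_v)/H_v) = #H_v` by half-length.

WHAT (namespace `…Theorems.GenusExact.AuxiliaryClass`; `S ⊆ T` finite sets of finite places, `H_v` half-length on `S`).
* `sq_natCard_map_solutions_ge` — the displayed-input form: `∏_{w ∈ T \ S} #H¹(K_w, E[p^k]) ≤ #(loc_T V)²`.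
* `sq_natCard_solutions_ge` — hence `∏_{w ∈ T \ S} #H¹(K_w, E[p^k]) ≤ #V²` (`V` itself, a finite group: `finite_kummerOutside`).
* `sq_natCard_solutions_ge_unconditional` — the same from the tree theorems `poitouTate_selmerStructure_duality_holds`,
  `localEulerPoincareCharacteristic_holds`, `exists_weilPairing_holds` (K totally complex, `k ≥ 1`), with the right side read
  through Tate's count: `∏_{w ∈ T \ S} (#E(K_w)[p^k] · #(𝓞_w/p^k))² ≤ #V²`, i.e. **`∏_{w∈T∖S} #E(K_w)[p^k] · #(𝓞_w/p^k) ≤ #V`**.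

HONEST FRAMING: `K` totally complex; closes nothing; whether (E1) closes I4 is the pen's call (the extra relaxed place costs a
reciprocity term).  BSD is NOT proved by any of this.

References: [McCallumLMS1991] §2 Prop. 2.1 (p. 300), §5 pp. 308–310; [MilneADT2006] Ch. I Cor. 2.3, Thm. 2.8, Thm. 4.10(b).
-/

set_option autoImplicit false
-- the Theorems namespace of this sub repeats the summit name by design (D-0017 nested layout)
set_option linter.dupNamespace false

noncomputable section

open scoped Classical

open CategoryTheory Field NumberField IsDedekindDomain Function
open Literature.NumberTheory.EllipticCurves
open Literature.NumberTheory.GaloisRepresentations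
open Literature.NumberTheory.GaloisCohomology
open Summit.BirchSwinnertonDyer.Rank1Residual.X11b.KummerPT
open Summit.BirchSwinnertonDyer.Rank1Residual.X11b.Relaxation
open Summit.BirchSwinnertonDyer.Rank1Residual.X11b.SelmerLevelBound
open scoped ContRepresentation

namespace Summit.BirchSwinnertonDyer.BirchSwinnertonDyer.Theorems.GenusExact.AuxiliaryClass

section Kummer

variable {K : Type} [Field K] [NumberField K] (W : WeierstrassCurve K) [W.IsElliptic] (p k : ℕ)
  [Fact p.Prime]

variable (e : W.geomTorsion ((p ^ k : ℕ) : ℤ) → W.geomTorsion ((p ^ k : ℕ) : ℤ) → AlgebraicClosure K)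
  (hμ : ∀ S T, e S T ^ (p ^ k) = 1)
  (hadd₁ : ∀ S₁ S₂ T, e (S₁ + S₂) T = e S₁ T * e S₂ T)
  (hadd₂ : ∀ S T₁ T₂, e S (T₁ + T₂) = e S T₁ * e S T₂)
  (hgal : ∀ (σ : absoluteGaloisGroup K) (S T : W.geomTorsion ((p ^ k : ℕ) : ℤ)),
    σ • e S T = e (σ • S) (σ • T))
  (halt : ∀ T, e T T = 1) (hnondeg : ∀ T, (∀ S, e S T = 1) → T = 0)

include e hμ hadd₁ hadd₂ hgal halt hnondeg in
/-- **McCallum's Prop. 2.1 in counting form (displayed inputs).**  `S ⊆ T` finite sets of finite places, `H_v ≤ H¹(K_v, E[p^k])`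
with `#H_v² = #H¹(K_v, E[p^k])` for `v ∈ S`, NO condition at the relaxed places `T ∖ S`; `V = H¹_{𝓛, ⊤ on T} ⊓ ⨅_{v∈S} loc_v⁻¹(H_v)`
the solution group, `loc_T` the product localisation (characterised by `hloc`).  Then
`∏_{w ∈ T ∖ S} #H¹(K_w, E[p^k]) ≤ #loc_T(V)²`.  (McCallum: `T ∖ S = {w}`, and `#H¹(K_w, E_m) > 1` gives a non-zero element.)
[cite: McCallumLMS1991, §2 Prop. 2.1 (proof)] [cite: MilneADT2006, Ch. I, Thm. 4.10(b)] -/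
theorem sq_natCard_map_solutions_ge (hK : ∀ w : InfinitePlace K, w.IsComplex)
    {inv : LocalInvariants K (p ^ k)} (hperf : inv.IsPerfect) (hsum : inv.SumLocalTermEqZero)
    (hcompl : inv.SelmerComplement)
    (hEuler : ∀ v : HeightOneSpectrum (𝓞 K),
      Nat.card (galoisCohomology ((W.torsionGaloisModule ((p ^ k : ℕ) : ℤ)).toLocal (Sum.inr v)) 1) =
        (Nat.card (nsmulAddMonoidHom (p ^ k) :
            (W.baseChange (v.adicCompletion K)).toAffine.Point →+ _).ker *
          Nat.card (v.adicCompletionIntegers K ⧸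
            Ideal.span {((p ^ k : ℕ) : v.adicCompletionIntegers K)})) ^ 2)
    (S T : Finset (HeightOneSpectrum (𝓞 K))) (hST : S ⊆ T)
    (H : ∀ v : HeightOneSpectrum (𝓞 K),
      AddSubgroup (galoisCohomology ((W.torsionGaloisModule ((p ^ k : ℕ) : ℤ)).toLocal (Sum.inr v)) 1))
    (hH : ∀ v ∈ S, Nat.card (H v) ^ 2 =
      Nat.card (galoisCohomology ((W.torsionGaloisModule ((p ^ k : ℕ) : ℤ)).toLocal (Sum.inr v)) 1))
    (loc : galoisCohomology (W.torsionGaloisModule ((p ^ k : ℕ) : ℤ)) 1 →+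
      (∀ u : ↥T, galoisCohomology ((W.torsionGaloisModule ((p ^ k : ℕ) : ℤ)).toLocal
        (Sum.inr (u : HeightOneSpectrum (𝓞 K)))) 1))
    (hloc : ∀ c u, loc c u = galoisCohomology.localization (W.torsionGaloisModule ((p ^ k : ℕ) : ℤ))
      (Sum.inr (u : HeightOneSpectrum (𝓞 K))) 1 c) :
    ∏ w ∈ T \ S, Nat.card (galoisCohomology ((W.torsionGaloisModule ((p ^ k : ℕ) : ℤ)).toLocal (Sum.inr w)) 1) ≤
      Nat.card ((kummerOutside W (p ^ k) (T.map Function.Embedding.inr) ⊓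
        ⨅ v ∈ S, (H v).comap (galoisCohomology.localization (W.torsionGaloisModule ((p ^ k : ℕ) : ℤ)) (Sum.inr v) 1)).map
          loc) ^ 2 := by
  classical
  -- the image `G` of the product localisation and McCallum's count
  obtain ⟨G, hG⟩ : ∃ G : AddSubgroup (∀ u : ↥T, galoisCohomology
      ((W.torsionGaloisModule ((p ^ k : ℕ) : ℤ)).toLocal (Sum.inr (u : HeightOneSpectrum (𝓞 K)))) 1),
      G = (kummerOutside W (p ^ k) (T.map Function.Embedding.inr)).map loc := ⟨_, rfl⟩
  haveI hfin : ∀ u : HeightOneSpectrum (𝓞 K), Finite (galoisCohomology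
      ((W.torsionGaloisModule ((p ^ k : ℕ) : ℤ)).toLocal (Sum.inr u)) 1) :=
    fun u ↦ finite_galoisCohomology_toLocal_inr W (p ^ k) u
  haveI : Finite (∀ u : ↥T, galoisCohomology ((W.torsionGaloisModule ((p ^ k : ℕ) : ℤ)).toLocal
      (Sum.inr (u : HeightOneSpectrum (𝓞 K)))) 1) := Pi.finite
  have hGsq : Nat.card G ^ 2 =
      (∏ w ∈ T \ S, Nat.card (galoisCohomology ((W.torsionGaloisModule ((p ^ k : ℕ) : ℤ)).toLocal (Sum.inr w)) 1)) *
        ∏ v ∈ S, Nat.card (galoisCohomology ((W.torsionGaloisModule ((p ^ k : ℕ) : ℤ)).toLocal (Sum.inr v)) 1) := by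
    rw [hG, natCard_map_kummerOutside_sq W p k e hμ hadd₁ hadd₂ hgal halt hnondeg hK hperf hsum hcompl hEuler T loc hloc,
      ← Finset.prod_sdiff hST]
  -- local sizes
  have hq : ∀ v ∈ S, Nat.card (galoisCohomology ((W.torsionGaloisModule ((p ^ k : ℕ) : ℤ)).toLocal
      (Sum.inr v)) 1 ⧸ H v) = Nat.card (H v) := by
    intro v hv
    have h1 := AddSubgroup.card_eq_card_quotient_mul_card_addSubgroup (H v)
    have h2 := hH v hv
    have hpos : 0 < Nat.card (H v) := Nat.card_pos
    apply Nat.eq_of_mul_eq_mul_right hpos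
    rw [← h1, ← h2, sq]
  have hprod : ∏ v ∈ S, Nat.card (galoisCohomology ((W.torsionGaloisModule ((p ^ k : ℕ) : ℤ)).toLocal
      (Sum.inr v)) 1) = (∏ v ∈ S, Nat.card (H v)) ^ 2 := by
    rw [← Finset.prod_pow]
    exact Finset.prod_congr rfl fun v hv ↦ (hH v hv).symm
  -- the projection `π : Π_{u∈T} H¹(K_u) → Π_{v∈S} H¹(K_v)/H_v`
  obtain ⟨π, hπ⟩ : ∃ π : (∀ u : ↥T, galoisCohomology ((W.torsionGaloisModule ((p ^ k : ℕ) : ℤ)).toLocal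
      (Sum.inr (u : HeightOneSpectrum (𝓞 K)))) 1) →+
      (∀ v : ↥S, galoisCohomology ((W.torsionGaloisModule ((p ^ k : ℕ) : ℤ)).toLocal
        (Sum.inr (v : HeightOneSpectrum (𝓞 K)))) 1 ⧸ H v),
      ∀ x v, π x v = QuotientAddGroup.mk (x ⟨v, hST v.2⟩) :=
    ⟨AddMonoidHom.pi fun v : ↥S ↦ (QuotientAddGroup.mk' (H v)).comp
      (Pi.evalAddMonoidHom (fun u : ↥T ↦ galoisCohomology
        ((W.torsionGaloisModule ((p ^ k : ℕ) : ℤ)).toLocal (Sum.inr (u : HeightOneSpectrum (𝓞 K)))) 1)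
        ⟨v, hST v.2⟩), fun x v ↦ rfl⟩
  -- `#G ≤ #(Π_{v∈S} H¹(K_v)/H_v) · #ker(π|_G)` and `ker(π|_G) ↪ loc_T(V)`
  haveI : Finite (∀ v : ↥S, galoisCohomology ((W.torsionGaloisModule ((p ^ k : ℕ) : ℤ)).toLocal
      (Sum.inr (v : HeightOneSpectrum (𝓞 K)))) 1 ⧸ H v) := Pi.finite
  have hker_le : Nat.card (π.comp G.subtype).ker ≤
      Nat.card ((kummerOutside W (p ^ k) (T.map Function.Embedding.inr) ⊓
        ⨅ v ∈ S, (H v).comap (galoisCohomology.localization (W.torsionGaloisModule ((p ^ k : ℕ) : ℤ))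
          (Sum.inr v) 1)).map loc) := by
    refine Nat.card_le_card_of_injective (fun g ↦ ⟨g.1.1, ?_⟩) (fun a b h ↦ ?_)
    · -- a kernel element of `π|_G` lies in `loc_T(V)`
      have hgG : g.1.1 ∈ (kummerOutside W (p ^ k) (T.map Function.Embedding.inr)).map loc := (le_of_eq hG) g.1.2
      obtain ⟨c, hc, hcg⟩ := hgG
      refine ⟨c, ⟨hc, AddSubgroup.mem_iInf.mpr fun v ↦ AddSubgroup.mem_iInf.mpr fun hv ↦ ?_⟩, hcg⟩
      have h0 : (π.comp G.subtype) g.1 = 0 := g.2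
      have h := congr_fun h0 ⟨v, hv⟩
      change π g.1.1 ⟨v, hv⟩ = 0 at h
      rw [hπ, QuotientAddGroup.eq_zero_iff, ← hcg, hloc] at h
      exact h
    · have h' := congrArg Subtype.val h
      dsimp only at h'
      exact Subtype.ext (Subtype.ext h')
  have hGle : Nat.card G ≤ (∏ v ∈ S, Nat.card (H v)) * Nat.card (π.comp G.subtype).ker := by
    rw [AddSubgroup.card_eq_card_quotient_mul_card_addSubgroup (π.comp G.subtype).ker,
      Nat.card_congr (QuotientAddGroup.quotientKerEquivRange (π.comp G.subtype)).toEquiv]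
    refine Nat.mul_le_mul_right _ ?_
    refine (AddSubgroup.card_le_card_addGroup _).trans ?_
    rw [Nat.card_pi, Finset.prod_coe_sort S fun v ↦ Nat.card (galoisCohomology
      ((W.torsionGaloisModule ((p ^ k : ℕ) : ℤ)).toLocal (Sum.inr v)) 1 ⧸ H v)]
    exact (Finset.prod_congr rfl hq).le
  -- arithmetic: `Q · P² = #G² ≤ (P · #ker)² ≤ (P · #N)²` with `P = ∏_S #H_v > 0`
  have hPpos : 0 < (∏ v ∈ S, Nat.card (H v)) ^ 2 :=
    pow_pos (Finset.prod_pos fun v _ ↦ (Nat.card_pos (α := H v))) 2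
  have h1 : Nat.card G ^ 2 ≤ ((∏ v ∈ S, Nat.card (H v)) * Nat.card ((kummerOutside W (p ^ k)
      (T.map Function.Embedding.inr) ⊓ ⨅ v ∈ S, (H v).comap (galoisCohomology.localization
        (W.torsionGaloisModule ((p ^ k : ℕ) : ℤ)) (Sum.inr v) 1)).map loc)) ^ 2 :=
    Nat.pow_le_pow_left (hGle.trans (Nat.mul_le_mul_left _ hker_le)) 2
  rw [hGsq, hprod, mul_pow, mul_comm] at h1
  exact Nat.le_of_mul_le_mul_left h1 hPpos

include e hμ hadd₁ hadd₂ hgal halt hnondeg in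
/-- **The solution group itself is at least that large**: `∏_{w ∈ T ∖ S} #H¹(K_w, E[p^k]) ≤ #V²` for
`V = H¹_{𝓛, ⊤ on T}(K, E[p^k]) ⊓ ⨅_{v∈S} loc_v⁻¹(H_v)` (finite, inside the finite `kummerOutside`), from
`sq_natCard_map_solutions_ge` and `#loc_T(V) ≤ #V`. [cite: McCallumLMS1991, §2 Prop. 2.1 (proof)] -/
theorem sq_natCard_solutions_ge (hK : ∀ w : InfinitePlace K, w.IsComplex)
    {inv : LocalInvariants K (p ^ k)} (hperf : inv.IsPerfect) (hsum : inv.SumLocalTermEqZero)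
    (hcompl : inv.SelmerComplement)
    (hEuler : ∀ v : HeightOneSpectrum (𝓞 K),
      Nat.card (galoisCohomology ((W.torsionGaloisModule ((p ^ k : ℕ) : ℤ)).toLocal (Sum.inr v)) 1) =
        (Nat.card (nsmulAddMonoidHom (p ^ k) :
            (W.baseChange (v.adicCompletion K)).toAffine.Point →+ _).ker *
          Nat.card (v.adicCompletionIntegers K ⧸
            Ideal.span {((p ^ k : ℕ) : v.adicCompletionIntegers K)})) ^ 2)
    (S T : Finset (HeightOneSpectrum (𝓞 K))) (hST : S ⊆ T)
    (H : ∀ v : HeightOneSpectrum (𝓞 K),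
      AddSubgroup (galoisCohomology ((W.torsionGaloisModule ((p ^ k : ℕ) : ℤ)).toLocal (Sum.inr v)) 1))
    (hH : ∀ v ∈ S, Nat.card (H v) ^ 2 =
      Nat.card (galoisCohomology ((W.torsionGaloisModule ((p ^ k : ℕ) : ℤ)).toLocal (Sum.inr v)) 1)) :
    ∏ w ∈ T \ S, Nat.card (galoisCohomology ((W.torsionGaloisModule ((p ^ k : ℕ) : ℤ)).toLocal (Sum.inr w)) 1) ≤
      Nat.card (kummerOutside W (p ^ k) (T.map Function.Embedding.inr) ⊓
        ⨅ v ∈ S, (H v).comap (galoisCohomology.localization (W.torsionGaloisModule ((p ^ k : ℕ) : ℤ))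
          (Sum.inr v) 1) : AddSubgroup _) ^ 2 := by
  classical
  obtain ⟨loc, hloc⟩ : ∃ loc : galoisCohomology (W.torsionGaloisModule ((p ^ k : ℕ) : ℤ)) 1 →+
      (∀ u : ↥T, galoisCohomology ((W.torsionGaloisModule ((p ^ k : ℕ) : ℤ)).toLocal
        (Sum.inr (u : HeightOneSpectrum (𝓞 K)))) 1),
      ∀ c u, loc c u = galoisCohomology.localization (W.torsionGaloisModule ((p ^ k : ℕ) : ℤ))
        (Sum.inr (u : HeightOneSpectrum (𝓞 K))) 1 c :=
    ⟨AddMonoidHom.pi fun u ↦ galoisCohomology.localization (W.torsionGaloisModule ((p ^ k : ℕ) : ℤ))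
      (Sum.inr (u : HeightOneSpectrum (𝓞 K))) 1, fun c u ↦ rfl⟩
  obtain ⟨V, hV⟩ : ∃ V : AddSubgroup (W.galH1Torsion ((p ^ k : ℕ) : ℤ)),
      V = kummerOutside W (p ^ k) (T.map Function.Embedding.inr) ⊓
        ⨅ v ∈ S, (H v).comap (galoisCohomology.localization (W.torsionGaloisModule ((p ^ k : ℕ) : ℤ))
          (Sum.inr v) 1) := ⟨_, rfl⟩
  have hfinKO : Finite (kummerOutside W (p ^ k) (T.map Function.Embedding.inr)) :=
    finite_kummerOutside W (p ^ k) _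
  have hle : V ≤ kummerOutside W (p ^ k) (T.map Function.Embedding.inr) := by rw [hV]; exact inf_le_left
  haveI : Finite V := @Finite.of_injective _ _ hfinKO (AddSubgroup.inclusion hle) (AddSubgroup.inclusion_injective hle)
  have h := sq_natCard_map_solutions_ge W p k e hμ hadd₁ hadd₂ hgal halt hnondeg hK hperf hsum hcompl hEuler S T hST H hH
    loc hloc
  rw [← hV] at h ⊢
  have hmap : Nat.card (V.map loc) ≤ Nat.card V :=
    Nat.card_le_card_of_surjective _ (AddMonoidHom.addSubgroupMap_surjective loc V)
  exact h.trans (Nat.pow_le_pow_left hmap 2)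

/-- **UNCONDITIONAL counting form** (the named facts are the tree theorems `poitouTate_selmerStructure_duality_holds`,
`localEulerPoincareCharacteristic_holds`; Weil pairing `exists_weilPairing_holds`): for `E = W` elliptic over a totally complex
number field `K`, `k ≥ 1`, finite sets `S ⊆ T` of finite places and half-length `H_v` (`v ∈ S`), the solution group
`V = H¹_{𝓛, ⊤ on T}(K, E[p^k]) ⊓ ⨅_{v∈S} loc_v⁻¹(H_v)` satisfies
**`∏_{w ∈ T ∖ S} #E(K_w)[p^k] · #(𝓞_w / p^k) ≤ #V`** (Tate's count `#H¹(K_w, E[p^k]) = (#E(K_w)[p^k] · #(𝓞_w/p^k))²`).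
[cite: McCallumLMS1991, §2 Prop. 2.1 (proof)] [cite: MilneADT2006, Ch. I, Thm. 2.8 and Thm. 4.10(b)] -/
theorem prod_torsion_le_natCard_solutions (hK : ∀ w : InfinitePlace K, w.IsComplex) (hk : 0 < k)
    (S T : Finset (HeightOneSpectrum (𝓞 K))) (hST : S ⊆ T)
    (H : ∀ v : HeightOneSpectrum (𝓞 K),
      AddSubgroup (galoisCohomology ((W.torsionGaloisModule ((p ^ k : ℕ) : ℤ)).toLocal (Sum.inr v)) 1))
    (hH : ∀ v ∈ S, Nat.card (H v) ^ 2 =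
      Nat.card (galoisCohomology ((W.torsionGaloisModule ((p ^ k : ℕ) : ℤ)).toLocal (Sum.inr v)) 1)) :
    ∏ w ∈ T \ S, (Nat.card (nsmulAddMonoidHom (p ^ k) :
        (W.baseChange (w.adicCompletion K)).toAffine.Point →+ _).ker *
      Nat.card (w.adicCompletionIntegers K ⧸ Ideal.span {((p ^ k : ℕ) : w.adicCompletionIntegers K)})) ≤
      Nat.card (kummerOutside W (p ^ k) (T.map Function.Embedding.inr) ⊓
        ⨅ v ∈ S, (H v).comap (galoisCohomology.localization (W.torsionGaloisModule ((p ^ k : ℕ) : ℤ))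
          (Sum.inr v) 1) : AddSubgroup _) := by
  have hprime : p.Prime := Fact.out
  have hpp : IsPrimePow (p ^ k) := ⟨p, k, hprime.prime, hk, rfl⟩
  have hp2 : 2 ≤ p ^ k := le_trans hprime.two_le (Nat.le_self_pow hk.ne' p)
  have hchar : ((p ^ k : ℕ) : K) ≠ 0 := Nat.cast_ne_zero.mpr (pow_ne_zero _ hprime.ne_zero)
  obtain ⟨e, hμ, hadd₁, hadd₂, halt, hnondeg, hgal⟩ := W.exists_weilPairing_holds (p ^ k) hp2 hchar
  obtain ⟨inv, hperf, hsum, -, hcompl⟩ :=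
    Summit.BirchSwinnertonDyer.BirchSwinnertonDyer.Theorems.SchneiderFreeAdditiveX3.PoitouTateReduction.poitouTate_selmerStructure_duality_holds
      K (p ^ k)
  have hEuler : ∀ v : HeightOneSpectrum (𝓞 K),
      Nat.card (galoisCohomology ((W.torsionGaloisModule ((p ^ k : ℕ) : ℤ)).toLocal (Sum.inr v)) 1) =
        (Nat.card (nsmulAddMonoidHom (p ^ k) :
            (W.baseChange (v.adicCompletion K)).toAffine.Point →+ _).ker *
          Nat.card (v.adicCompletionIntegers K ⧸
            Ideal.span {((p ^ k : ℕ) : v.adicCompletionIntegers K)})) ^ 2 := fun v ↦ by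
    haveI : CharZero (v.adicCompletion K) := charZero_adicCompletion v
    exact natCard_galoisCohomology_one_torsion_adicCompletion_eq_sq W v (p ^ k) hpp
      (localEulerPoincareCharacteristic_holds (v.adicCompletion K))
  have h := sq_natCard_solutions_ge W p k e hμ hadd₁ hadd₂ hgal halt hnondeg hK hperf hsum hcompl hEuler S T hST H hH
  rw [Finset.prod_congr rfl (fun w _ ↦ hEuler w), Finset.prod_pow] at h
  exact (Nat.pow_le_pow_iff_left two_ne_zero).mp h

end Kummer

end Summit.BirchSwinnertonDyer.BirchSwinnertonDyer.Theorems.GenusExact.AuxiliaryClass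

end
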